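import Literature.Computability.FineGrained.IPRenameBlockPass
import HarnessLib

/-!
# The renaming machine of Impagliazzo–Paturi's Lemma 2, V: looking the renaming variable up in the Y-table

Family `fine-grained` (trunk T-CPLX-FINE). Fifth file of the machine half of Impagliazzo–Paturi's Lemma 2. The value of an unforced
`B`-variable `x` is that of its renaming variable `y_{i,r}` (`IPRename.yval`: `r` the number of
unforced variables before `x` in its block `i`), whose new index the machine finds in the
`Y`-table `wYT` (`IPRenameTables.lean`) and then looks up in the tuple register.

* `yBody` / `yPart` — one loop over a copy of the `Y`-table with a four-state mode: skip `iu2`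
  blocks, pass the `f_i` blanks, skip `ru` index tokens, read the next one into the probe and
  call `lookupVal` (`IPRenameLookup.lean`); store family `ySt`.
* Segment lemmas (`segRuns_y_skip*`, `segRuns_y_blanks`, `segRuns_y_skipNum(s)`,
  `segRuns_y_readNum`, `segRuns_y_ignore`), the looked-up value `yLook L ys r`, and
  **`runs_yPart`**: `yv := flagW (yLook L (t[i]).2 r)` within `(bpK L + 10) · |wYT t| + 2 r + 12`
  steps; `bpSt_eta`, `ySt_eta` (every store is a member of each family over itself, the device
  by which the hypothesis forms of the next file are derived).

## References

* R. Impagliazzo, R. Paturi, *On the complexity of k-SAT*, J. Comput. System Sci. 62 (2001)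
  367–375, doi:10.1006/jcss.2000.1727, Lemma 2 (p. 373) and its "Moreover" sentence (the
  reduction is computable within the stated time); pp. 371–372 (`G_x`, `Ψ`, `Θ_i`, `Φ_f`).
  (Not held; acquisition request acq-00143.)
* T. Nipkow, G. Klein, *Concrete Semantics with Isabelle/HOL*, Springer 2014, Ch. 7 (big-step
  reasoning about loops, as in `SymbolPrograms.lean`).
-/

namespace Literature.Computability.FineGrained.IPRenameM

open _root_.Computability Complexity Complexity.ACom Sparsifier IPRename

/-! ### Looking up the renaming variable in the `Y`-table: programs -/

/-- Body of the pass over the copy `ytw` of the `Y`-table. Modes in `md2`: `bra` (skipping the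
blocks before the wanted one, `iu2` of them), nothing (the `f_i` blanks of the wanted block),
`comma` (its index tokens: `ru` of them are skipped, the next one is read into `pr` and looked
up), `blank` (done: ignore). [folklore] -/
def yBody (s : Γ') : RProg :=
  pop (kr KR.md2) fun o => match o, s with
    | some Γ'.bra, Γ'.ket => pop (kr KR.iu2) fun _ => ifTop (kr KR.iu2) fun o' => match o' with
        | some _ => push (kr KR.md2) Γ'.bra
        | none => skip
    | some Γ'.bra, _ => push (kr KR.md2) Γ'.bra
    | none, Γ'.blank => skip
    | none, Γ'.comma => push (kr KR.md2) Γ'.comma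
    | some Γ'.comma, Γ'.bit d => (ifTop (kr KR.ru) fun o' => match o' with
        | some _ => skip
        | none => push (kr KR.pr) (Γ'.bit d)) ;; push (kr KR.md2) Γ'.comma
    | some Γ'.comma, Γ'.comma => ifTop (kr KR.ru) fun o' => match o' with
        | some _ => pop (kr KR.ru) (fun _ => skip) ;; push (kr KR.md2) Γ'.comma
        | none => lookupVal ;; (pop (kr KR.val) fun o'' => match o'' with
            | some _ => push (kr KR.yv) Γ'.blank
            | none => skip) ;; clear (kr KR.pr) ;; push (kr KR.md2) Γ'.blank
    | some Γ'.comma, Γ'.ket => push (kr KR.md2) Γ'.blank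
    | some Γ'.blank, _ => push (kr KR.md2) Γ'.blank
    | _, _ => skip

/-- **The `Y`-lookup**: with `iu2 = i` ticks and `ru = r` ticks, set `yv` to the value under the
tuple of the `r`-th renaming variable of block `i` of the `Y`-table `yt` (down if there is none),
emptying `iu2` and `ru` and keeping `yt`. [folklore] -/
def yPart : RProg :=
  copyToG (kr KR.yt) (kr KR.ytw) (kr KR.t1) (kr KR.t2) ;;
  (ifTop (kr KR.iu2) fun o => match o with
    | some _ => push (kr KR.md2) Γ'.bra
    | none => skip) ;;
  loop (kr KR.ytw) yBody ;; clear (kr KR.md2) ;; clear (kr KR.ru)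

/-! ### The `Y`-lookup: store family -/

/-- The store during the `Y`-lookup. [folklore] -/
def ySt (S : RStore) (ytw md2 iu2 ru pr val yv : List Γ') : RStore := fun r =>
  if r = kr KR.ytw then ytw else
  if r = kr KR.md2 then md2 else
  if r = kr KR.iu2 then iu2 else
  if r = kr KR.ru then ru else
  if r = kr KR.pr then pr else
  if r = kr KR.val then val else
  if r = kr KR.yv then yv else
  S r

section YSt

variable (S : RStore) (ytw md2 iu2 ru pr val yv w : List Γ')

/-- Reading `ytw`. [folklore] -/
@[simp] theorem ySt_ytw : ySt S ytw md2 iu2 ru pr val yv (kr KR.ytw) = ytw := by simp [ySt]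

/-- Reading `md2`. [folklore] -/
@[simp] theorem ySt_md2 : ySt S ytw md2 iu2 ru pr val yv (kr KR.md2) = md2 := by simp [ySt]

/-- Reading `iu2`. [folklore] -/
@[simp] theorem ySt_iu2 : ySt S ytw md2 iu2 ru pr val yv (kr KR.iu2) = iu2 := by simp [ySt]

/-- Reading `ru`. [folklore] -/
@[simp] theorem ySt_ru : ySt S ytw md2 iu2 ru pr val yv (kr KR.ru) = ru := by simp [ySt]

/-- Reading `pr`. [folklore] -/
@[simp] theorem ySt_pr : ySt S ytw md2 iu2 ru pr val yv (kr KR.pr) = pr := by simp [ySt]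

/-- Reading `val`. [folklore] -/
@[simp] theorem ySt_val : ySt S ytw md2 iu2 ru pr val yv (kr KR.val) = val := by simp [ySt]

/-- Reading `yv`. [folklore] -/
@[simp] theorem ySt_yv : ySt S ytw md2 iu2 ru pr val yv (kr KR.yv) = yv := by simp [ySt]

/-- Reading any other register. [folklore] -/
theorem ySt_other {r : Reg} (h0 : r ≠ kr KR.ytw) (h1 : r ≠ kr KR.md2) (h2 : r ≠ kr KR.iu2) (h3 : r ≠ kr KR.ru) (h4 : r ≠ kr KR.pr) (h5 : r ≠ kr KR.val) (h6 : r ≠ kr KR.yv) :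
    ySt S ytw md2 iu2 ru pr val yv r = S r := by
  simp [ySt, h0, h1, h2, h3, h4, h5, h6]

/-- Reading `vw`. [folklore] -/
@[simp] theorem ySt_vw : ySt S ytw md2 iu2 ru pr val yv (kr KR.vw) = S (kr KR.vw) := by simp [ySt]

/-- Reading `fnd`. [folklore] -/
@[simp] theorem ySt_fnd : ySt S ytw md2 iu2 ru pr val yv (kr KR.fnd) = S (kr KR.fnd) := by simp [ySt]

/-- Reading `ex`. [folklore] -/
@[simp] theorem ySt_ex : ySt S ytw md2 iu2 ru pr val yv (kr KR.ex) = S (kr KR.ex) := by simp [ySt]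

/-- Reading `eb`. [folklore] -/
@[simp] theorem ySt_eb : ySt S ytw md2 iu2 ru pr val yv (kr KR.eb) = S (kr KR.eb) := by simp [ySt]

/-- Reading `lmd`. [folklore] -/
@[simp] theorem ySt_lmd : ySt S ytw md2 iu2 ru pr val yv (kr KR.lmd) = S (kr KR.lmd) := by simp [ySt]

/-- Reading `ne`. [folklore] -/
@[simp] theorem ySt_ne : ySt S ytw md2 iu2 ru pr val yv (kr KR.ne) = S (kr KR.ne) := by simp [ySt]

/-- Reading `x2`. [folklore] -/
@[simp] theorem ySt_x2 : ySt S ytw md2 iu2 ru pr val yv (kr KR.x2) = S (kr KR.x2) := by simp [ySt]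

/-- Reading `t1`. [folklore] -/
@[simp] theorem ySt_t1 : ySt S ytw md2 iu2 ru pr val yv (kr KR.t1) = S (kr KR.t1) := by simp [ySt]

/-- Reading `t2`. [folklore] -/
@[simp] theorem ySt_t2 : ySt S ytw md2 iu2 ru pr val yv (kr KR.t2) = S (kr KR.t2) := by simp [ySt]

/-- Reading `yt`. [folklore] -/
@[simp] theorem ySt_yt : ySt S ytw md2 iu2 ru pr val yv (kr KR.yt) = S (kr KR.yt) := by simp [ySt]

/-- Reading `vt`. [folklore] -/
@[simp] theorem ySt_vt : ySt S ytw md2 iu2 ru pr val yv (tb TB.vt) = S (tb TB.vt) := by simp [ySt]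

/-- Updating `ytw`. [folklore] -/
@[simp] theorem update_ySt_ytw :
    Function.update (ySt S ytw md2 iu2 ru pr val yv) (kr KR.ytw) w = ySt S w md2 iu2 ru pr val yv := by
  funext r; by_cases h : r = kr KR.ytw
  · subst h; simp
  · rw [Function.update_of_ne h]; simp [ySt, h]

/-- Updating `md2`. [folklore] -/
@[simp] theorem update_ySt_md2 :
    Function.update (ySt S ytw md2 iu2 ru pr val yv) (kr KR.md2) w = ySt S ytw w iu2 ru pr val yv := by
  funext r; by_cases h : r = kr KR.md2
  · subst h; simp
  · rw [Function.update_of_ne h]; simp [ySt, h]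

/-- Updating `iu2`. [folklore] -/
@[simp] theorem update_ySt_iu2 :
    Function.update (ySt S ytw md2 iu2 ru pr val yv) (kr KR.iu2) w = ySt S ytw md2 w ru pr val yv := by
  funext r; by_cases h : r = kr KR.iu2
  · subst h; simp
  · rw [Function.update_of_ne h]; simp [ySt, h]

/-- Updating `ru`. [folklore] -/
@[simp] theorem update_ySt_ru :
    Function.update (ySt S ytw md2 iu2 ru pr val yv) (kr KR.ru) w = ySt S ytw md2 iu2 w pr val yv := by
  funext r; by_cases h : r = kr KR.ru
  · subst h; simp
  · rw [Function.update_of_ne h]; simp [ySt, h]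

/-- Updating `pr`. [folklore] -/
@[simp] theorem update_ySt_pr :
    Function.update (ySt S ytw md2 iu2 ru pr val yv) (kr KR.pr) w = ySt S ytw md2 iu2 ru w val yv := by
  funext r; by_cases h : r = kr KR.pr
  · subst h; simp
  · rw [Function.update_of_ne h]; simp [ySt, h]

/-- Updating `val`. [folklore] -/
@[simp] theorem update_ySt_val :
    Function.update (ySt S ytw md2 iu2 ru pr val yv) (kr KR.val) w = ySt S ytw md2 iu2 ru pr w yv := by
  funext r; by_cases h : r = kr KR.val
  · subst h; simp
  · rw [Function.update_of_ne h]; simp [ySt, h]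

/-- Updating `yv`. [folklore] -/
@[simp] theorem update_ySt_yv :
    Function.update (ySt S ytw md2 iu2 ru pr val yv) (kr KR.yv) w = ySt S ytw md2 iu2 ru pr val w := by
  funext r; by_cases h : r = kr KR.yv
  · subst h; simp
  · rw [Function.update_of_ne h]; simp [ySt, h]

end YSt

/-! ### The `Y`-lookup: specifications -/

/-- `ket` does not occur in an index token. [folklore] -/
theorem ket_not_mem_wIdx (y : ℕ) : Γ'.ket ∉ wIdx y := by simp [wIdx]

/-- `ket` occurs in a `Y`-block only at its end. [folklore] -/
theorem ket_not_mem_yBlock_prefix (f : ℕ) (ys : List ℕ) :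
    Γ'.ket ∉ List.replicate f Γ'.blank ++ Γ'.comma :: ys.flatMap wIdx := by
  simp [wIdx]

/-- A `Y`-block is its `ket`-free prefix closed by `ket`. [folklore] -/
theorem wYBlock_eq (f : ℕ) (ys : List ℕ) :
    wYBlock f ys = (List.replicate f Γ'.blank ++ Γ'.comma :: ys.flatMap wIdx) ++ [Γ'.ket] := by
  simp [wYBlock]

section YSpec

variable (S : RStore) (L : List Lit) (hB : BpBase S L)
include hB

omit hB in
/-- **Skipping** (mode `bra`): symbols other than `ket` are passed over. [folklore] -/
theorem segRuns_y_skip_inner (iu2 ru pr val yv : List Γ') :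
    ∀ (u : List Γ'), Γ'.ket ∉ u → ∀ rest : List Γ',
      SegRuns (kr KR.ytw) yBody u (ySt S (u ++ rest) [Γ'.bra] iu2 ru pr val yv)
        (ySt S rest [Γ'.bra] iu2 ru pr val yv) (5 * u.length)
  | [], _, rest => by simpa using SegRuns.nil (kr KR.ytw) yBody _
  | s :: u, hu, rest => by
    have hs : s ≠ Γ'.ket := fun h => hu (by simp [h])
    have hu' : Γ'.ket ∉ u := fun h => hu (by simp [h])
    have hbody : Runs (yBody s)
        (Function.update (ySt S (s :: u ++ rest) [Γ'.bra] iu2 ru pr val yv) (kr KR.ytw) (u ++ rest))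
        (ySt S (u ++ rest) [Γ'.bra] iu2 ru pr val yv) (1 + 2) := by
      rw [update_ySt_ytw]
      unfold yBody
      refine Runs.pop_cons (k := kr KR.md2) (a := Γ'.bra) (w := []) (by simp) ?_
      rw [update_ySt_md2]
      cases s with
      | ket => exact absurd rfl hs
      | bit b => exact Runs.push' (by simp)
      | bra => exact Runs.push' (by simp)
      | blank => exact Runs.push' (by simp)
      | comma => exact Runs.push' (by simp)
    have ih := segRuns_y_skip_inner iu2 ru pr val yv u hu' rest
    have hk : ySt S (s :: u ++ rest) [Γ'.bra] iu2 ru pr val yv (kr KR.ytw) = s :: (u ++ rest) := by simp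
    refine (SegRuns.cons hk hbody ih).cast rfl rfl rfl ?_
    simp only [List.length_cons]; omega

omit hB in
/-- **Skipping one `Y`-block.** [folklore] -/
theorem segRuns_y_skip_block (ru pr val yv : List Γ') (f : ℕ) (ys : List ℕ) (u rest : List Γ') :
    SegRuns (kr KR.ytw) yBody (wYBlock f ys)
      (ySt S (wYBlock f ys ++ rest) [Γ'.bra] (Γ'.blank :: u) ru pr val yv)
      (ySt S rest (if u = [] then [] else [Γ'.bra]) u ru pr val yv) (10 * (wYBlock f ys).length) := by
  rw [wYBlock_eq]
  set pre := List.replicate f Γ'.blank ++ Γ'.comma :: ys.flatMap wIdx with hpre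
  have h1 := segRuns_y_skip_inner S (Γ'.blank :: u) ru pr val yv pre
    (by rw [hpre]; exact ket_not_mem_yBlock_prefix f ys) ([Γ'.ket] ++ rest)
  have h2 : Runs (yBody Γ'.ket)
      (Function.update (ySt S ([Γ'.ket] ++ rest) [Γ'.bra] (Γ'.blank :: u) ru pr val yv) (kr KR.ytw) rest)
      (ySt S rest (if u = [] then [] else [Γ'.bra]) u ru pr val yv) (4 + 2 + 2) := by
    rw [update_ySt_ytw]
    unfold yBody
    refine Runs.pop_cons (k := kr KR.md2) (a := Γ'.bra) (w := []) (by simp) ?_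
    rw [update_ySt_md2]
    refine Runs.pop_cons (k := kr KR.iu2) (a := Γ'.blank) (w := u) (by simp) ?_
    rw [update_ySt_iu2]
    cases u with
    | nil =>
      rw [if_pos rfl]
      exact (Runs.ifTop_nil (by simp) (Runs.skip _)).mono (by norm_num)
    | cons t u =>
      rw [if_neg (List.cons_ne_nil _ _)]
      exact Runs.ifTop_cons (x := t) (w := u) (by simp) (Runs.push' (by simp))
  have hk2 : ySt S ([Γ'.ket] ++ rest) [Γ'.bra] (Γ'.blank :: u) ru pr val yv (kr KR.ytw) = Γ'.ket :: rest := by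
    simp
  have := h1.append (SegRuns.single hk2 h2)
  refine this.cast rfl (by simp) rfl ?_
  simp only [List.length_append, List.length_singleton]; omega

omit hB in
/-- **Skipping the `Y`-blocks before the wanted one.** [folklore] -/
theorem segRuns_y_skip (ru pr val yv : List Γ') : ∀ (t : List (ℕ × List ℕ)) (u rest : List Γ'), t ≠ [] →
    SegRuns (kr KR.ytw) yBody (t.flatMap fun b => wYBlock b.1 b.2)
      (ySt S ((t.flatMap fun b => wYBlock b.1 b.2) ++ rest) [Γ'.bra] (ticks Γ'.blank t.length ++ u) ru pr val yv)
      (ySt S rest (if u = [] then [] else [Γ'.bra]) u ru pr val yv)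
      (10 * (t.flatMap fun b => wYBlock b.1 b.2).length)
  | [], _, _, h => absurd rfl h
  | [b], u, rest, _ => by
    have := segRuns_y_skip_block S ru pr val yv b.1 b.2 u rest
    refine this.cast (by simp) (by simp [ticks]) rfl (by simp)
  | b :: b' :: t, u, rest, _ => by
    have h1 := segRuns_y_skip_block S ru pr val yv b.1 b.2 (ticks Γ'.blank (b' :: t).length ++ u)
      (((b' :: t).flatMap fun b => wYBlock b.1 b.2) ++ rest)
    have hne : ticks Γ'.blank (b' :: t).length ++ u ≠ [] := by simp [ticks]
    rw [if_neg hne] at h1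
    have h2 := segRuns_y_skip ru pr val yv (b' :: t) u rest (List.cons_ne_nil _ _)
    have := h1.append h2
    refine this.cast (by simp) ?_ rfl ?_
    · simp [ticks, List.replicate_succ]
    · simp only [List.flatMap_cons, List.length_append]; omega

omit hB in
/-- **The `f`-blanks of the wanted block** are passed over (mode empty), the comma switches to the
index tokens. [folklore] -/
theorem segRuns_y_blanks (ru pr val yv : List Γ') (f : ℕ) (rest : List Γ') :
    SegRuns (kr KR.ytw) yBody (List.replicate f Γ'.blank ++ [Γ'.comma])
      (ySt S (List.replicate f Γ'.blank ++ [Γ'.comma] ++ rest) [] [] ru pr val yv)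
      (ySt S rest [Γ'.comma] [] ru pr val yv) (5 * (f + 1)) := by
  have h1 : ∀ rest' : List Γ', SegRuns (kr KR.ytw) yBody (List.replicate f Γ'.blank)
      (ySt S (List.replicate f Γ'.blank ++ rest') [] [] ru pr val yv) (ySt S rest' [] [] ru pr val yv)
      (4 * f) := by
    induction f with
    | zero => intro rest'; simpa using SegRuns.nil (kr KR.ytw) yBody _
    | succ f ih =>
      intro rest'
      have hbody : Runs (yBody Γ'.blank)
          (Function.update (ySt S (Γ'.blank :: (List.replicate f Γ'.blank ++ rest')) [] [] ru pr val yv)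
            (kr KR.ytw) (List.replicate f Γ'.blank ++ rest'))
          (ySt S (List.replicate f Γ'.blank ++ rest') [] [] ru pr val yv) (0 + 2) := by
        rw [update_ySt_ytw]
        unfold yBody
        exact Runs.pop_nil (by simp) (Runs.skip _)
      have hk : ySt S (Γ'.blank :: (List.replicate f Γ'.blank ++ rest')) [] [] ru pr val yv (kr KR.ytw) =
          Γ'.blank :: (List.replicate f Γ'.blank ++ rest') := by simp
      refine (SegRuns.cons hk hbody (ih rest')).cast (by simp [List.replicate_succ]) (by simp [List.replicate_succ])
        rfl (by omega)
  have h2 : Runs (yBody Γ'.comma)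
      (Function.update (ySt S ([Γ'.comma] ++ rest) [] [] ru pr val yv) (kr KR.ytw) rest)
      (ySt S rest [Γ'.comma] [] ru pr val yv) (1 + 2) := by
    rw [update_ySt_ytw]
    unfold yBody
    exact Runs.pop_nil (by simp) (Runs.push' (by simp))
  have hk2 : ySt S ([Γ'.comma] ++ rest) [] [] ru pr val yv (kr KR.ytw) = Γ'.comma :: rest := by simp
  have := (h1 ([Γ'.comma] ++ rest)).append (SegRuns.single hk2 h2)
  refine this.cast rfl (by simp) rfl ?_
  omega

omit hB in
/-- **Skipping one index token** (counter `ru` nonempty): it is decremented. [folklore] -/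
theorem segRuns_y_skipNum (val yv : List Γ') (y : ℕ) (u rest : List Γ') :
    SegRuns (kr KR.ytw) yBody (wIdx y)
      (ySt S (wIdx y ++ rest) [Γ'.comma] [] (Γ'.blank :: u) [] val yv)
      (ySt S rest [Γ'.comma] [] u [] val yv) (10 * (wIdx y).length) := by
  have h1 : ∀ (bs : List Bool) (rest' : List Γ'), SegRuns (kr KR.ytw) yBody (bs.map Γ'.bit)
      (ySt S (bs.map Γ'.bit ++ rest') [Γ'.comma] [] (Γ'.blank :: u) [] val yv)
      (ySt S rest' [Γ'.comma] [] (Γ'.blank :: u) [] val yv) (8 * bs.length) := by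
    intro bs
    induction bs with
    | nil => intro rest'; simpa using SegRuns.nil (kr KR.ytw) yBody _
    | cons d bs ih =>
      intro rest'
      have hbody : Runs (yBody (Γ'.bit d))
          (Function.update (ySt S (Γ'.bit d :: (bs.map Γ'.bit ++ rest')) [Γ'.comma] [] (Γ'.blank :: u) [] val yv)
            (kr KR.ytw) (bs.map Γ'.bit ++ rest'))
          (ySt S (bs.map Γ'.bit ++ rest') [Γ'.comma] [] (Γ'.blank :: u) [] val yv) (0 + 3 + 1 + 2) := by
        rw [update_ySt_ytw]
        unfold yBody
        refine Runs.pop_cons (k := kr KR.md2) (a := Γ'.comma) (w := []) (by simp) ?_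
        rw [update_ySt_md2]
        exact (Runs.ifTop_cons (x := Γ'.blank) (w := u) (by simp) (Runs.skip _)).seq (Runs.push' (by simp))
      have hk : ySt S (Γ'.bit d :: (bs.map Γ'.bit ++ rest')) [Γ'.comma] [] (Γ'.blank :: u) [] val yv (kr KR.ytw) =
          Γ'.bit d :: (bs.map Γ'.bit ++ rest') := by simp
      refine (SegRuns.cons hk hbody (ih rest')).cast (by simp) (by simp) rfl ?_
      simp only [List.length_cons]; omega
  have h2 : Runs (yBody Γ'.comma)
      (Function.update (ySt S ([Γ'.comma] ++ rest) [Γ'.comma] [] (Γ'.blank :: u) [] val yv) (kr KR.ytw) rest)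
      (ySt S rest [Γ'.comma] [] u [] val yv) (0 + 2 + 1 + 3 + 2) := by
    rw [update_ySt_ytw]
    unfold yBody
    refine Runs.pop_cons (k := kr KR.md2) (a := Γ'.comma) (w := []) (by simp) ?_
    rw [update_ySt_md2]
    refine Runs.ifTop_cons (x := Γ'.blank) (w := u) (by simp) ?_
    have inner : Runs (pop (kr KR.ru) (fun _ => skip) ;; push (kr KR.md2) Γ'.comma)
        (ySt S rest [] [] (Γ'.blank :: u) [] val yv) (ySt S rest [Γ'.comma] [] u [] val yv) (0 + 2 + 1) := by
      refine (Runs.pop_cons (k := kr KR.ru) (a := Γ'.blank) (w := u)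
        (R := ySt S rest [] [] (Γ'.blank :: u) [] val yv) (by simp) (Runs.skip _)).seq ?_
      rw [update_ySt_ru]
      exact Runs.push' (by simp)
    exact inner
  have hk2 : ySt S ([Γ'.comma] ++ rest) [Γ'.comma] [] (Γ'.blank :: u) [] val yv (kr KR.ytw) = Γ'.comma :: rest := by
    simp
  have := (h1 (encodeNat y) ([Γ'.comma] ++ rest)).append (SegRuns.single hk2 h2)
  rw [wIdx_eq]
  refine this.cast rfl (by simp) rfl ?_
  simp only [List.length_append, List.length_map, List.length_singleton]; omega

omit hB in
/-- **Skipping index tokens**: `min r |ys|` of them. [folklore] -/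
theorem segRuns_y_skipNums (val yv : List Γ') : ∀ (ys : List ℕ) (r : ℕ) (rest : List Γ'), ys.length ≤ r →
    SegRuns (kr KR.ytw) yBody (ys.flatMap wIdx)
      (ySt S (ys.flatMap wIdx ++ rest) [Γ'.comma] [] (ticks Γ'.blank r) [] val yv)
      (ySt S rest [Γ'.comma] [] (ticks Γ'.blank (r - ys.length)) [] val yv) (10 * (ys.flatMap wIdx).length)
  | [], r, rest, _ => by simpa using SegRuns.nil (kr KR.ytw) yBody _
  | y :: ys, r, rest, hr => by
    obtain ⟨r, rfl⟩ : ∃ r', r = r' + 1 := ⟨r - 1, by simp at hr; omega⟩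
    have h1 := segRuns_y_skipNum S val yv y (ticks Γ'.blank r) (ys.flatMap wIdx ++ rest)
    have h2 := segRuns_y_skipNums val yv ys r rest (by simp at hr; omega)
    have := h1.append h2
    refine this.cast (by simp) (by simp [ticks_succ]) (by simp) ?_
    simp only [List.flatMap_cons, List.length_append]; omega

/-- **Reading the wanted index token** (counter `ru` empty) and looking its value up: `yv`
becomes that value, and the mode switches to done. [folklore] -/
theorem segRuns_y_readNum (y : ℕ) (rest : List Γ') :
    SegRuns (kr KR.ytw) yBody (wIdx y)
      (ySt S (wIdx y ++ rest) [Γ'.comma] [] [] [] [] [])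
      (ySt S rest [Γ'.blank] [] [] [] [] (flagW Γ'.blank (lookupB L y = true))) (bpK L * (wIdx y).length) := by
  have h1 : ∀ (bs : List Bool) (rest' pr : List Γ'), SegRuns (kr KR.ytw) yBody (bs.map Γ'.bit)
      (ySt S (bs.map Γ'.bit ++ rest') [Γ'.comma] [] [] pr [] [])
      (ySt S rest' [Γ'.comma] [] [] ((bs.map Γ'.bit).reverse ++ pr) [] []) (8 * bs.length) := by
    intro bs
    induction bs with
    | nil => intro rest' pr; simpa using SegRuns.nil (kr KR.ytw) yBody _
    | cons d bs ih =>
      intro rest' pr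
      have hbody : Runs (yBody (Γ'.bit d))
          (Function.update (ySt S (Γ'.bit d :: (bs.map Γ'.bit ++ rest')) [Γ'.comma] [] [] pr [] [])
            (kr KR.ytw) (bs.map Γ'.bit ++ rest'))
          (ySt S (bs.map Γ'.bit ++ rest') [Γ'.comma] [] [] (Γ'.bit d :: pr) [] []) (1 + 2 + 1 + 2) := by
        rw [update_ySt_ytw]
        unfold yBody
        refine Runs.pop_cons (k := kr KR.md2) (a := Γ'.comma) (w := []) (by simp) ?_
        rw [update_ySt_md2]
        refine (Runs.ifTop_nil (by simp) (Runs.push' (R' := ySt S (bs.map Γ'.bit ++ rest') [] [] []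
          (Γ'.bit d :: pr) [] []) (by simp))).seq (Runs.push' (by simp))
      have hk : ySt S (Γ'.bit d :: (bs.map Γ'.bit ++ rest')) [Γ'.comma] [] [] pr [] [] (kr KR.ytw) =
          Γ'.bit d :: (bs.map Γ'.bit ++ rest') := by simp
      refine (SegRuns.cons hk hbody (ih rest' (Γ'.bit d :: pr))).cast (by simp) (by simp) (by simp) ?_
      simp only [List.length_cons]; omega
  -- the comma: look the token up
  have h2 : Runs (yBody Γ'.comma)
      (Function.update (ySt S ([Γ'.comma] ++ rest) [Γ'.comma] [] [] (rbits y) [] []) (kr KR.ytw) rest)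
      (ySt S rest [Γ'.blank] [] [] [] [] (flagW Γ'.blank (lookupB L y = true)))
      (((12 * (rbits y).length + 46) * (cbody L).length + 10) + (3 + ((2 * (rbits y).length + 1) + 1)) + 2 + 2) := by
    rw [update_ySt_ytw]
    unfold yBody
    refine Runs.pop_cons (k := kr KR.md2) (a := Γ'.comma) (w := []) (by simp) ?_
    rw [update_ySt_md2]
    refine Runs.ifTop_nil (by simp) ?_
    dsimp only
    set R := ySt S rest [] [] [] (rbits y) [] [] with hR
    have hl := runs_lookupVal R y L (by simp [hR]) (by simp [hR, hB.vt]) (by simp [hR, hB.vw])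
      (by simp [hR, hB.fnd]) (by simp [hR]) (by simp [hR, hB.ex]) (by simp [hR, hB.eb]) (by simp [hR, hB.lmd])
      (by simp [hR, hB.ne]) (by simp [hR, hB.x2]) (by simp [hR, hB.t1]) (by simp [hR, hB.t2])
    rw [hR, update_ySt_val] at hl
    refine hl.seq ?_
    have hv : Runs (pop (kr KR.val) fun o'' => match o'' with
        | some _ => push (kr KR.yv) Γ'.blank
        | none => skip)
        (ySt S rest [] [] [] (rbits y) (flagW Γ'.blank (lookupB L y = true)) [])
        (ySt S rest [] [] [] (rbits y) [] (flagW Γ'.blank (lookupB L y = true))) 3 := by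
      by_cases hy : lookupB L y = true
      · rw [flagW_true _ hy]
        refine Runs.pop_cons (k := kr KR.val) (a := Γ'.blank) (w := []) (by simp) ?_
        rw [update_ySt_val]; exact Runs.push' (by simp)
      · rw [flagW_false _ hy]
        exact (Runs.pop_nil (by simp) (Runs.skip _)).mono (by norm_num)
    refine hv.seq ?_
    have hc := runs_clear (kr KR.pr) (ySt S rest [] [] [] (rbits y) [] (flagW Γ'.blank (lookupB L y = true)))
    rw [ySt_pr, update_ySt_pr] at hc
    exact hc.seq (Runs.push' (by simp))
  have hk2 : ySt S ([Γ'.comma] ++ rest) [Γ'.comma] [] [] (rbits y) [] [] (kr KR.ytw) = Γ'.comma :: rest := by simp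
  have h1' := h1 (encodeNat y) ([Γ'.comma] ++ rest) []
  rw [List.append_nil] at h1'
  have hrb : ((encodeNat y).map Γ'.bit).reverse = rbits y := rfl
  rw [hrb] at h1'
  have := h1'.append (SegRuns.single hk2 h2)
  rw [wIdx_eq]
  refine this.cast rfl (by simp) rfl ?_
  have hr : (rbits y).length = (encodeNat y).length := by simp [rbits]
  simp only [List.length_append, List.length_map, List.length_singleton, bpK, hr]
  nlinarith [Nat.zero_le ((encodeNat y).length * (cbody L).length)]

omit hB in
/-- **Done**: every further symbol is ignored (mode `blank`). [folklore] -/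
theorem segRuns_y_ignore (iu2 ru pr val yv : List Γ') :
    ∀ (u rest : List Γ'), SegRuns (kr KR.ytw) yBody u (ySt S (u ++ rest) [Γ'.blank] iu2 ru pr val yv)
      (ySt S rest [Γ'.blank] iu2 ru pr val yv) (5 * u.length)
  | [], rest => by simpa using SegRuns.nil (kr KR.ytw) yBody _
  | s :: u, rest => by
    have hbody : Runs (yBody s)
        (Function.update (ySt S (s :: u ++ rest) [Γ'.blank] iu2 ru pr val yv) (kr KR.ytw) (u ++ rest))
        (ySt S (u ++ rest) [Γ'.blank] iu2 ru pr val yv) (1 + 2) := by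
      rw [update_ySt_ytw]
      unfold yBody
      refine Runs.pop_cons (k := kr KR.md2) (a := Γ'.blank) (w := []) (by simp) ?_
      rw [update_ySt_md2]
      cases s <;> exact Runs.push' (by simp)
    have ih := segRuns_y_ignore iu2 ru pr val yv u rest
    have hk : ySt S (s :: u ++ rest) [Γ'.blank] iu2 ru pr val yv (kr KR.ytw) = s :: (u ++ rest) := by simp
    refine (SegRuns.cons hk hbody ih).cast rfl rfl rfl ?_
    simp only [List.length_cons]; omega

end YSpec

/-- The value looked up in the `Y`-table: the value under the tuple of the `r`-th index of `ys`
(`false` if there is none). [folklore] -/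
def yLook (L : List Lit) (ys : List ℕ) (r : ℕ) : Bool := ((ys[r]?).map (lookupB L)).getD false

/-- **Specification of `yPart`.** [folklore] -/
theorem runs_yPart (S : RStore) (L : List Lit) (hB : BpBase S L) (t : List (ℕ × List ℕ)) (i r : ℕ)
    (hi : i < t.length) (hyt : S (kr KR.yt) = wYT t) :
    Runs yPart (ySt S [] [] (ticks Γ'.blank i) (ticks Γ'.blank r) [] [] [])
      (ySt S [] [] [] [] [] [] (flagW Γ'.blank (yLook L (t[i]).2 r = true)))
      ((bpK L + 10) * (wYT t).length + 2 * r + 12) := by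
  set f := (t[i]).1 with hf
  set ys := (t[i]).2 with hys0
  have ht : t[i] = (f, ys) := by rw [hf, hys0]
  have hsplit : t = t.take i ++ (f, ys) :: t.drop (i + 1) := by
    rw [← ht, ← List.drop_eq_getElem_cons hi, List.take_append_drop]
  set B : ℕ × List ℕ → List Γ' := fun b => wYBlock b.1 b.2 with hBdef
  set tail := (t.drop (i + 1)).flatMap B with htail
  have hwYT : wYT t = (t.take i).flatMap B ++ (wYBlock f ys ++ tail) := by
    conv_lhs => rw [hsplit]
    simp [wYT, hBdef, htail]
  have hK : 60 ≤ bpK L := by simp [bpK]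
  unfold yPart
  -- the copy
  have h0 := runs_copyToG (a := kr KR.yt) (b := kr KR.ytw) (t₁ := kr KR.t1) (t₂ := kr KR.t2)
    (by simp) (by simp) (by simp) (by simp) (by simp) (by simp)
    (ySt S [] [] (ticks Γ'.blank i) (ticks Γ'.blank r) [] [] []) (by simp [hB.t1]) (by simp [hB.t2]) (by simp)
  rw [ySt_yt, hyt, update_ySt_ytw] at h0
  -- the prelude and the skipping
  have hpre : Runs ((ifTop (kr KR.iu2) fun o => match o with
        | some _ => push (kr KR.md2) Γ'.bra
        | none => skip))
      (ySt S (wYT t) [] (ticks Γ'.blank i) (ticks Γ'.blank r) [] [] [])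
      (ySt S (wYT t) (if i = 0 then [] else [Γ'.bra]) (ticks Γ'.blank i) (ticks Γ'.blank r) [] [] []) 4 := by
    cases i with
    | zero =>
      rw [if_pos rfl]
      exact (Runs.ifTop_nil (by simp [ticks]) (Runs.skip _)).mono (by norm_num)
    | succ i =>
      rw [if_neg (Nat.succ_ne_zero i)]
      exact Runs.ifTop_cons (x := Γ'.blank) (w := ticks Γ'.blank i) (by simp [ticks_succ]) (Runs.push' (by simp))
  have hskip : SegRuns (kr KR.ytw) yBody ((t.take i).flatMap B)
      (ySt S (wYT t) (if i = 0 then [] else [Γ'.bra]) (ticks Γ'.blank i) (ticks Γ'.blank r) [] [] [])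
      (ySt S (wYBlock f ys ++ tail) [] [] (ticks Γ'.blank r) [] [] [])
      (10 * ((t.take i).flatMap B).length) := by
    cases i with
    | zero =>
      rw [if_pos rfl, hwYT]
      simp only [List.take_zero, List.flatMap_nil, List.nil_append, List.length_nil, Nat.mul_zero, ticks_zero]
      exact SegRuns.nil (kr KR.ytw) yBody _
    | succ i =>
      rw [if_neg (Nat.succ_ne_zero i)]
      have hne : t.take (i + 1) ≠ [] := by
        rw [Ne, List.take_eq_nil_iff]; simp only [Nat.succ_ne_zero, false_or]
        rintro rfl; simp at hi
      have hlen : (t.take (i + 1)).length = i + 1 := List.length_take_of_le (by omega)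
      have := segRuns_y_skip S (ticks Γ'.blank r) [] [] [] (t.take (i + 1)) [] (wYBlock f ys ++ tail) hne
      rw [if_pos rfl, hlen, List.append_nil] at this
      refine this.cast rfl (by rw [hwYT]) rfl le_rfl
  set tail0 := Γ'.ket :: tail with htail0
  have hN5 : wYBlock f ys ++ tail = List.replicate f Γ'.blank ++ (Γ'.comma :: (ys.flatMap wIdx ++ tail0)) := by
    rw [wYBlock_eq]; simp [htail0]
  have hskip' := hskip.cast rfl rfl (show ySt S (wYBlock f ys ++ tail) [] [] (ticks Γ'.blank r) [] [] [] =
      ySt S (List.replicate f Γ'.blank ++ (Γ'.comma :: (ys.flatMap wIdx ++ tail0))) [] [] (ticks Γ'.blank r) [] [] []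
      by rw [hN5]) le_rfl
  -- the blanks of the wanted block
  have hblanks := (segRuns_y_blanks S (ticks Γ'.blank r) [] [] [] f (ys.flatMap wIdx ++ tail0)).cast rfl
    (show ySt S (List.replicate f Γ'.blank ++ [Γ'.comma] ++ (ys.flatMap wIdx ++ tail0)) [] [] (ticks Γ'.blank r) [] [] [] =
      ySt S (List.replicate f Γ'.blank ++ (Γ'.comma :: (ys.flatMap wIdx ++ tail0))) [] [] (ticks Γ'.blank r) [] [] []
      by simp) rfl le_rfl
  have hlenW : (wYT t).length = ((t.take i).flatMap B).length + f + 1 + (ys.flatMap wIdx).length + 1 + tail.length := by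
    rw [hwYT, wYBlock_eq]
    simp only [List.length_append, List.length_replicate, List.length_cons, List.length_nil]
    omega
  -- the index tokens
  by_cases hr : r < ys.length
  · -- the wanted token exists
    have hdrop : ys.drop r = ys[r] :: ys.drop (r + 1) := List.drop_eq_getElem_cons hr
    have hyw : ys.flatMap wIdx = (ys.take r).flatMap wIdx ++ (wIdx ys[r] ++ (ys.drop (r + 1)).flatMap wIdx) := by
      conv_lhs => rw [← List.take_append_drop r ys]
      rw [List.flatMap_append, hdrop, List.flatMap_cons]
    set N1 := (ys.drop (r + 1)).flatMap wIdx ++ tail0 with hN1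
    have hN3 : ys.flatMap wIdx ++ tail0 = (ys.take r).flatMap wIdx ++ (wIdx ys[r] ++ N1) := by
      rw [hyw]; simp [hN1]
    rw [hN3] at hskip' hblanks
    have hsk := segRuns_y_skipNums S [] [] (ys.take r) r (wIdx ys[r] ++ N1) (by simp)
    have htk : (ys.take r).length = r := List.length_take_of_le hr.le
    rw [htk, Nat.sub_self, ticks_zero] at hsk
    have hrd := segRuns_y_readNum S L hB ys[r] N1
    have hig := (segRuns_y_ignore S [] [] [] [] (flagW Γ'.blank (lookupB L ys[r] = true))
      ((ys.drop (r + 1)).flatMap wIdx ++ tail0) []).cast rfl (by rw [List.append_nil]) rfl le_rfl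
    have hloop := (hskip'.append (hblanks.append (hsk.append (hrd.append hig)))).runs_loop_nil (by simp)
    have hc1 := runs_clear (kr KR.md2) (ySt S [] [Γ'.blank] [] [] [] [] (flagW Γ'.blank (lookupB L ys[r] = true)))
    rw [ySt_md2, update_ySt_md2] at hc1
    have hc2 := runs_clear (kr KR.ru) (ySt S [] [] [] [] [] [] (flagW Γ'.blank (lookupB L ys[r] = true)))
    rw [ySt_ru, update_ySt_ru] at hc2
    have hlook : lookupB L ys[r] = yLook L ys r := by
      simp [yLook, List.getElem?_eq_getElem hr]
    rw [hlook] at hc2 hc1 hloop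
    refine (h0.seq (hpre.seq (hloop.seq (hc1.seq hc2)))).cast rfl rfl ?_
    have hl2 : (ys.flatMap wIdx).length = ((ys.take r).flatMap wIdx).length + (wIdx ys[r]).length +
        ((ys.drop (r + 1)).flatMap wIdx).length := by
      rw [hyw]; simp only [List.length_append]; omega
    have hN1l : N1.length = ((ys.drop (r + 1)).flatMap wIdx).length + 1 + tail.length := by
      simp [hN1, htail0]; omega
    rw [hlenW]
    have ht0 : tail0.length = tail.length + 1 := by simp [htail0]
    simp only [List.length_append, List.length_singleton, List.length_nil, ht0]
    rw [hl2]
    nlinarith [hK, Nat.zero_le (((t.take i).flatMap B).length), Nat.zero_le ((wIdx ys[r]).length),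
      Nat.zero_le (((ys.drop (r + 1)).flatMap wIdx).length), Nat.zero_le tail.length,
      Nat.zero_le (((ys.take r).flatMap wIdx).length)]
  · -- no such token: skip them all, stop at the closing ket
    push Not at hr
    have hsk := segRuns_y_skipNums S [] [] ys r tail0 hr
    have hket : Runs (yBody Γ'.ket)
        (Function.update (ySt S tail0 [Γ'.comma] [] (ticks Γ'.blank (r - ys.length)) [] [] [])
          (kr KR.ytw) tail)
        (ySt S tail [Γ'.blank] [] (ticks Γ'.blank (r - ys.length)) [] [] []) (1 + 2) := by
      rw [update_ySt_ytw]
      unfold yBody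
      refine Runs.pop_cons (k := kr KR.md2) (a := Γ'.comma) (w := []) (by simp) ?_
      rw [update_ySt_md2]
      exact Runs.push' (by simp)
    have hkk : ySt S tail0 [Γ'.comma] [] (ticks Γ'.blank (r - ys.length)) [] [] [] (kr KR.ytw) =
        Γ'.ket :: tail := by simp [htail0]
    have hig := (segRuns_y_ignore S [] (ticks Γ'.blank (r - ys.length)) [] [] [] tail []).cast rfl
      (by rw [List.append_nil]) rfl le_rfl
    have hloop := (hskip'.append (hblanks.append (hsk.append ((SegRuns.single hkk hket).append hig)))).runs_loop_nil
      (by simp)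
    have hc1 := runs_clear (kr KR.md2) (ySt S [] [Γ'.blank] [] (ticks Γ'.blank (r - ys.length)) [] [] [])
    rw [ySt_md2, update_ySt_md2] at hc1
    have hc2 := runs_clear (kr KR.ru) (ySt S [] [] [] (ticks Γ'.blank (r - ys.length)) [] [] [])
    rw [ySt_ru, update_ySt_ru] at hc2
    have hlook : yLook L ys r = false := by
      simp [yLook, List.getElem?_eq_none hr]
    rw [hlook, flagW_false _ (by simp)]
    refine (h0.seq (hpre.seq (hloop.seq (hc1.seq hc2)))).cast rfl rfl ?_
    rw [hlenW]
    simp only [List.length_nil, length_ticks, List.length_cons]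
    nlinarith [hK, Nat.zero_le (((t.take i).flatMap B).length), Nat.zero_le tail.length,
      Nat.zero_le ((ys.flatMap wIdx).length), Nat.sub_le r ys.length]

/-! ### The block pass and the `Y`-lookup on an arbitrary store -/

/-- Every store is a `bpSt` over itself. [folklore] -/
theorem bpSt_eta (R : RStore) :
    bpSt R (R (kr KR.btw)) (R (kr KR.md2)) (R (kr KR.pt)) (R (kr KR.pf)) (R (kr KR.lpol)) (R (kr KR.pr)) (R (kr KR.allf)) (R (kr KR.ft)) (R (kr KR.ff)) (R (kr KR.gt)) (R (kr KR.gf)) (R (kr KR.pos)) (R (kr KR.done)) (R (kr KR.ru)) (R (kr KR.cntf)) (R (kr KR.val)) = R := by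
  funext r
  by_cases h0 : r = kr KR.btw
  · subst h0; simp
  by_cases h1 : r = kr KR.md2
  · subst h1; simp
  by_cases h2 : r = kr KR.pt
  · subst h2; simp
  by_cases h3 : r = kr KR.pf
  · subst h3; simp
  by_cases h4 : r = kr KR.lpol
  · subst h4; simp
  by_cases h5 : r = kr KR.pr
  · subst h5; simp
  by_cases h6 : r = kr KR.allf
  · subst h6; simp
  by_cases h7 : r = kr KR.ft
  · subst h7; simp
  by_cases h8 : r = kr KR.ff
  · subst h8; simp
  by_cases h9 : r = kr KR.gt
  · subst h9; simp
  by_cases h10 : r = kr KR.gf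
  · subst h10; simp
  by_cases h11 : r = kr KR.pos
  · subst h11; simp
  by_cases h12 : r = kr KR.done
  · subst h12; simp
  by_cases h13 : r = kr KR.ru
  · subst h13; simp
  by_cases h14 : r = kr KR.cntf
  · subst h14; simp
  by_cases h15 : r = kr KR.val
  · subst h15; simp
  rw [bpSt_other _ _ _ _ _ _ _ _ _ _ _ _ _ _ _ _ _ h0 h1 h2 h3 h4 h5 h6 h7 h8 h9 h10 h11 h12 h13 h14 h15]

/-- Every store is a `ySt` over itself. [folklore] -/
theorem ySt_eta (R : RStore) :
    ySt R (R (kr KR.ytw)) (R (kr KR.md2)) (R (kr KR.iu2)) (R (kr KR.ru)) (R (kr KR.pr)) (R (kr KR.val)) (R (kr KR.yv)) = R := by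
  funext r
  by_cases h0 : r = kr KR.ytw
  · subst h0; simp
  by_cases h1 : r = kr KR.md2
  · subst h1; simp
  by_cases h2 : r = kr KR.iu2
  · subst h2; simp
  by_cases h3 : r = kr KR.ru
  · subst h3; simp
  by_cases h4 : r = kr KR.pr
  · subst h4; simp
  by_cases h5 : r = kr KR.val
  · subst h5; simp
  by_cases h6 : r = kr KR.yv
  · subst h6; simp
  rw [ySt_other _ _ _ _ _ _ _ _ h0 h1 h2 h3 h4 h5 h6]

end Literature.Computability.FineGrained.IPRenameM
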